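import Mathlib.Analysis.Calculus.ContDiff.Basic
import Mathlib.Analysis.Calculus.FDeriv.Pi
import Literature.MathematicalPhysics.KineticTheory.InfiniteChainVariationalCalculus

/-!
# `NoLocalIntegrals` helper A: smooth local observables — representation, closure, site-dependence

Helper file of the support item `NoLocalIntegrals` (stmt-AtomisticToContinuum-12074) of route `LocalOhmBV`
(sub-problem `FouriersLaw`). Elementary API of the vocabulary of
`Literature.MathematicalPhysics.KineticTheory.InfiniteChainVariationalCalculus`:

* re-boxing of `C^∞` profiles on larger centred boxes (`isSmoothLocal_exists_rep`, `…_rep₂`);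
* smoothness of `e ↦ f (Φ e)` for a smooth local `f` along any coordinatewise-smooth family of
  configurations (`contDiff_comp_of_isSmoothLocal`), in particular along coordinate lines;
* closure of `IsSmoothLocal` under the algebra operations, composition with smooth real functions,
  re-indexing of the lattice (`shiftPow`, `shift`, `reflectZ`), freezing a site (`Function.update σ x v`),
  and under the coordinate partial derivatives `partialQZ`, `partialPZ`;
* a small `DependsOn` toolkit (sites a composite observable depends on).
-/

noncomputable section

open scoped ContDiff
open Set Function Literature.MathematicalPhysics.KineticTheory.HeatConduction

namespace Summit.AtomisticToContinuum.FouriersLaw.Theorems.LocalOhmBV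

variable {f g : ChainConfig → ℝ}

/-! ### Re-boxing -/

/-- A `C^∞` profile on a box `{a, …, a+n} ⊆ {-R, …, R}` re-boxes on the centred box. -/
theorem exists_contDiff_comp_boxRestrict_of_boxRestrictAt {a : ℤ} {n R : ℕ} (ha : -(R : ℤ) ≤ a)
    (hb : a + n ≤ R) {g : (Fin (n + 1) → ℝ × ℝ) → ℝ} (hg : ContDiff ℝ ∞ g) :
    ∃ g' : (Fin (2 * R + 1) → ℝ × ℝ) → ℝ, ContDiff ℝ ∞ g' ∧
      g ∘ boxRestrictAt a n = g' ∘ boxRestrict R := by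
  let idx : Fin (n + 1) → Fin (2 * R + 1) := fun i =>
    ⟨(a + i + R).toNat, by have := i.isLt; omega⟩
  have hidx : ∀ i : Fin (n + 1), ((idx i : ℕ) : ℤ) - R = a + i := by
    intro i
    have := i.isLt
    simp only [idx]
    omega
  let π : (Fin (2 * R + 1) → ℝ × ℝ) →L[ℝ] (Fin (n + 1) → ℝ × ℝ) :=
    ContinuousLinearMap.pi fun i => ContinuousLinearMap.proj (idx i)
  refine ⟨g ∘ π, hg.comp π.contDiff, ?_⟩
  funext σ
  simp only [Function.comp_apply]
  congr 1
  funext i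
  simp only [boxRestrictAt_apply, π, ContinuousLinearMap.pi_apply, ContinuousLinearMap.proj_apply,
    boxRestrict_apply, hidx]

/-- A smooth local observable is represented by a `C^∞` profile on EVERY large centred box. -/
theorem isSmoothLocal_exists_rep (hf : IsSmoothLocal f) :
    ∃ R₀ : ℕ, ∀ R : ℕ, R₀ ≤ R →
      ∃ g : (Fin (2 * R + 1) → ℝ × ℝ) → ℝ, ContDiff ℝ ∞ g ∧ f = g ∘ boxRestrict R := by
  obtain ⟨R₀, g, hg, rfl⟩ := hf
  refine ⟨R₀, fun R hR => ?_⟩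
  rw [boxRestrict_eq_boxRestrictAt]
  exact exists_contDiff_comp_boxRestrict_of_boxRestrictAt (by omega) (by push_cast; omega) hg

/-- Two smooth local observables are represented on a common centred box, of any large radius. -/
theorem isSmoothLocal_exists_rep₂ (hf : IsSmoothLocal f) (hg : IsSmoothLocal g) :
    ∃ R₀ : ℕ, ∀ R : ℕ, R₀ ≤ R → ∃ f' g' : (Fin (2 * R + 1) → ℝ × ℝ) → ℝ,
      ContDiff ℝ ∞ f' ∧ ContDiff ℝ ∞ g' ∧ f = f' ∘ boxRestrict R ∧ g = g' ∘ boxRestrict R := by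
  obtain ⟨R₁, h₁⟩ := isSmoothLocal_exists_rep hf
  obtain ⟨R₂, h₂⟩ := isSmoothLocal_exists_rep hg
  refine ⟨max R₁ R₂, fun R hR => ?_⟩
  obtain ⟨f', hf', hff'⟩ := h₁ R ((le_max_left _ _).trans hR)
  obtain ⟨g', hg', hgg'⟩ := h₂ R ((le_max_right _ _).trans hR)
  exact ⟨f', g', hf', hg', hff', hgg'⟩

/-! ### Smoothness along coordinatewise-smooth families of configurations -/

/-- If every coordinate of `Φ e` depends smoothly on `e`, then `e ↦ f (Φ e)` is smooth for a smooth
local `f`. -/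
theorem contDiff_comp_of_isSmoothLocal {E : Type*} [NormedAddCommGroup E] [NormedSpace ℝ E]
    (hf : IsSmoothLocal f) {Φ : E → ChainConfig} (hΦ : ∀ x : ℤ, ContDiff ℝ ∞ fun e => Φ e x) :
    ContDiff ℝ ∞ fun e => f (Φ e) := by
  obtain ⟨R, g, hg, rfl⟩ := hf
  have hbox : ContDiff ℝ ∞ fun e => boxRestrict R (Φ e) :=
    contDiff_pi.2 fun i => by simpa only [boxRestrict_apply] using hΦ ((i : ℤ) - R)
  exact hg.comp hbox

/-- A smooth local observable is smooth along a smooth curve in one site. -/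
theorem contDiff_update_of_isSmoothLocal (hf : IsSmoothLocal f) (σ : ChainConfig) (x : ℤ)
    {v : ℝ → ℝ × ℝ} (hv : ContDiff ℝ ∞ v) :
    ContDiff ℝ ∞ fun t => f (Function.update σ x (v t)) := by
  refine contDiff_comp_of_isSmoothLocal hf fun y => ?_
  by_cases h : y = x
  · subst h
    simpa only [Function.update_self] using hv
  · simpa only [Function.update_of_ne h] using contDiff_const

/-- A smooth local observable is smooth along the position line of any site. -/
theorem contDiff_lineQ (hf : IsSmoothLocal f) (σ : ChainConfig) (x : ℤ) (c : ℝ) :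
    ContDiff ℝ ∞ fun t => f (Function.update σ x (t, c)) :=
  contDiff_update_of_isSmoothLocal hf σ x (contDiff_id.prodMk contDiff_const)

/-- A smooth local observable is smooth along the momentum line of any site. -/
theorem contDiff_lineP (hf : IsSmoothLocal f) (σ : ChainConfig) (x : ℤ) (c : ℝ) :
    ContDiff ℝ ∞ fun t => f (Function.update σ x (c, t)) :=
  contDiff_update_of_isSmoothLocal hf σ x (contDiff_const.prodMk contDiff_id)

/-! ### Constructors and algebraic closure -/

/-- Constants are smooth local. -/
theorem isSmoothLocal_const (c : ℝ) : IsSmoothLocal fun _ => c :=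
  ⟨0, fun _ => c, contDiff_const, rfl⟩

/-- The position coordinate `σ ↦ q_x` is smooth local. -/
theorem isSmoothLocal_fst (x : ℤ) : IsSmoothLocal fun σ => (σ x).1 := by
  have : (fun σ : ChainConfig => (σ x).1) =
      (fun y : Fin (0 + 1) → ℝ × ℝ => (y 0).1) ∘ boxRestrictAt x 0 := by
    funext σ; simp
  rw [this]
  exact isSmoothLocal_comp_boxRestrictAt x 0 (contDiff_apply ℝ (ℝ × ℝ) (0 : Fin (0 + 1))).fst

/-- The momentum coordinate `σ ↦ p_x` is smooth local. -/
theorem isSmoothLocal_snd (x : ℤ) : IsSmoothLocal fun σ => (σ x).2 := by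
  have : (fun σ : ChainConfig => (σ x).2) =
      (fun y : Fin (0 + 1) → ℝ × ℝ => (y 0).2) ∘ boxRestrictAt x 0 := by
    funext σ; simp
  rw [this]
  exact isSmoothLocal_comp_boxRestrictAt x 0 (contDiff_apply ℝ (ℝ × ℝ) (0 : Fin (0 + 1))).snd

/-- Composition with a smooth function of two real variables preserves smooth locality. -/
theorem isSmoothLocal_comp₂ {φ : ℝ → ℝ → ℝ} (hφ : ContDiff ℝ ∞ fun z : ℝ × ℝ => φ z.1 z.2)
    (hf : IsSmoothLocal f) (hg : IsSmoothLocal g) : IsSmoothLocal fun σ => φ (f σ) (g σ) := by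
  obtain ⟨R₀, h⟩ := isSmoothLocal_exists_rep₂ hf hg
  obtain ⟨f', g', hf', hg', rfl, rfl⟩ := h R₀ le_rfl
  exact ⟨R₀, fun y => φ (f' y) (g' y), hφ.comp (hf'.prodMk hg'), rfl⟩

/-- Composition with a smooth real function preserves smooth locality. -/
theorem isSmoothLocal_comp {φ : ℝ → ℝ} (hφ : ContDiff ℝ ∞ φ) (hf : IsSmoothLocal f) :
    IsSmoothLocal fun σ => φ (f σ) := by
  obtain ⟨R, f', hf', rfl⟩ := hf
  exact ⟨R, fun y => φ (f' y), hφ.comp hf', rfl⟩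

/-- Sums of smooth local observables are smooth local. -/
theorem isSmoothLocal_add (hf : IsSmoothLocal f) (hg : IsSmoothLocal g) :
    IsSmoothLocal fun σ => f σ + g σ :=
  isSmoothLocal_comp₂ (φ := fun a b => a + b) (contDiff_fst.add contDiff_snd) hf hg

/-- Differences of smooth local observables are smooth local. -/
theorem isSmoothLocal_sub (hf : IsSmoothLocal f) (hg : IsSmoothLocal g) :
    IsSmoothLocal fun σ => f σ - g σ :=
  isSmoothLocal_comp₂ (φ := fun a b => a - b) (contDiff_fst.sub contDiff_snd) hf hg

/-- Products of smooth local observables are smooth local. -/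
theorem isSmoothLocal_mul (hf : IsSmoothLocal f) (hg : IsSmoothLocal g) :
    IsSmoothLocal fun σ => f σ * g σ :=
  isSmoothLocal_comp₂ (φ := fun a b => a * b) (contDiff_fst.mul contDiff_snd) hf hg

/-- Negation preserves smooth locality. -/
theorem isSmoothLocal_neg (hf : IsSmoothLocal f) : IsSmoothLocal fun σ => -f σ :=
  isSmoothLocal_comp (φ := fun a => -a) contDiff_neg hf

/-- Scalar multiples of smooth local observables are smooth local. -/
theorem isSmoothLocal_const_mul (c : ℝ) (hf : IsSmoothLocal f) : IsSmoothLocal fun σ => c * f σ :=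
  isSmoothLocal_comp (φ := fun a => c * a) (contDiff_const.mul contDiff_id) hf

/-- Powers of smooth local observables are smooth local. -/
theorem isSmoothLocal_pow (hf : IsSmoothLocal f) (m : ℕ) : IsSmoothLocal fun σ => f σ ^ m :=
  isSmoothLocal_comp (φ := fun a => a ^ m) (contDiff_id.pow m) hf

/-- The inverse of a nowhere-vanishing smooth local observable is smooth local. -/
theorem isSmoothLocal_inv (hf : IsSmoothLocal f) (h0 : ∀ σ, f σ ≠ 0) : IsSmoothLocal fun σ => (f σ)⁻¹ := by
  obtain ⟨R, f', hf', rfl⟩ := hf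
  -- modify the profile off the range so that it never vanishes: use `f' y` itself, which is nonzero at
  -- every box value `y` (every `y` is the box restriction of some configuration)
  have hne : ∀ y, f' y ≠ 0 := by
    intro y
    have := h0 (fun x => if h : (0 : ℤ) ≤ x + R ∧ x + R < 2 * R + 1 then y ⟨(x + R).toNat, by omega⟩
      else (0, 0))
    simp only [Function.comp_apply] at this
    convert this using 2
    funext i
    have hi := i.isLt
    simp only [boxRestrict_apply]
    rw [dif_pos ⟨by omega, by omega⟩]
    congr 1
    apply Fin.ext
    simp only
    omega
  exact ⟨R, fun y => (f' y)⁻¹, hf'.inv hne, rfl⟩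

/-- Quotients by a nowhere-vanishing smooth local observable are smooth local. -/
theorem isSmoothLocal_div (hf : IsSmoothLocal f) (hg : IsSmoothLocal g) (h0 : ∀ σ, g σ ≠ 0) :
    IsSmoothLocal fun σ => f σ / g σ := by
  simpa only [div_eq_mul_inv] using isSmoothLocal_mul hf (isSmoothLocal_inv hg h0)

/-- Finite sums of smooth local observables are smooth local. -/
theorem isSmoothLocal_sum {ι : Type*} (s : Finset ι) {F : ι → ChainConfig → ℝ}
    (hF : ∀ i ∈ s, IsSmoothLocal (F i)) : IsSmoothLocal fun σ => ∑ i ∈ s, F i σ := by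
  classical
  induction s using Finset.induction_on with
  | empty => simpa using isSmoothLocal_const 0
  | insert a s ha ih =>
    have h1 : IsSmoothLocal (F a) := hF a (Finset.mem_insert_self a s)
    have h2 := ih fun i hi => hF i (Finset.mem_insert_of_mem hi)
    simpa only [Finset.sum_insert ha] using isSmoothLocal_add h1 h2

/-- Finite products of smooth local observables are smooth local. -/
theorem isSmoothLocal_prod {ι : Type*} (s : Finset ι) {F : ι → ChainConfig → ℝ}
    (hF : ∀ i ∈ s, IsSmoothLocal (F i)) : IsSmoothLocal fun σ => ∏ i ∈ s, F i σ := by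
  classical
  induction s using Finset.induction_on with
  | empty => simpa using isSmoothLocal_const 1
  | insert a s ha ih =>
    have h1 : IsSmoothLocal (F a) := hF a (Finset.mem_insert_self a s)
    have h2 := ih fun i hi => hF i (Finset.mem_insert_of_mem hi)
    simpa only [Finset.prod_insert ha] using isSmoothLocal_mul h1 h2

/-! ### Re-indexing the lattice and freezing a site -/

/-- Re-indexing the lattice by any map `ρ : ℤ → ℤ` preserves smooth locality
(`σ ↦ f (σ ∘ ρ)`; covers the iterated shifts and the reflection). -/
theorem isSmoothLocal_comp_reindex (ρ : ℤ → ℤ) (hf : IsSmoothLocal f) :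
    IsSmoothLocal fun σ => f fun x => σ (ρ x) := by
  obtain ⟨R, g, hg, rfl⟩ := hf
  -- the sites read by the re-indexed observable
  let T : ℕ := Finset.univ.sup fun i : Fin (2 * R + 1) => (ρ ((i : ℤ) - R)).natAbs
  have hT : ∀ i : Fin (2 * R + 1), (ρ ((i : ℤ) - R)).natAbs ≤ T := fun i =>
    Finset.le_sup (f := fun i : Fin (2 * R + 1) => (ρ ((i : ℤ) - R)).natAbs) (Finset.mem_univ i)
  let idx : Fin (2 * R + 1) → Fin (2 * T + 1) := fun i =>
    ⟨(ρ ((i : ℤ) - R) + T).toNat, by have := hT i; omega⟩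
  have hidx : ∀ i : Fin (2 * R + 1), ((idx i : ℕ) : ℤ) - T = ρ ((i : ℤ) - R) := by
    intro i
    have := hT i
    simp only [idx]
    omega
  let π : (Fin (2 * T + 1) → ℝ × ℝ) →L[ℝ] (Fin (2 * R + 1) → ℝ × ℝ) :=
    ContinuousLinearMap.pi fun i => ContinuousLinearMap.proj (idx i)
  refine ⟨T, g ∘ π, hg.comp π.contDiff, ?_⟩
  funext σ
  simp only [Function.comp_apply]
  congr 1
  funext i
  simp only [boxRestrict_apply, π, ContinuousLinearMap.pi_apply, ContinuousLinearMap.proj_apply, hidx]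

/-- The iterated shifts preserve smooth locality. -/
theorem isSmoothLocal_comp_shiftPow (k : ℤ) (hf : IsSmoothLocal f) : IsSmoothLocal (f ∘ shiftPow k) :=
  isSmoothLocal_comp_reindex (fun x => x + k) hf

/-- The shift preserves smooth locality. -/
theorem isSmoothLocal_comp_shift (hf : IsSmoothLocal f) : IsSmoothLocal (f ∘ shift) :=
  isSmoothLocal_comp_reindex (fun x => x + 1) hf

/-- The reflection preserves smooth locality. -/
theorem isSmoothLocal_comp_reflectZ (hf : IsSmoothLocal f) : IsSmoothLocal (f ∘ reflectZ) :=
  isSmoothLocal_comp_reindex (fun x => -x) hf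

/-- Updating a site of a centred box moves the centred-box restriction by the corresponding update. -/
theorem boxRestrict_update_of_eq (R : ℕ) (σ : ChainConfig) (i : Fin (2 * R + 1)) (v : ℝ × ℝ) :
    boxRestrict R (Function.update σ ((i : ℤ) - R) v) = Function.update (boxRestrict R σ) i v := by
  have h := boxRestrictAt_update_of_eq (-(R : ℤ)) (2 * R) σ i v
  rw [boxRestrict_eq_boxRestrictAt]
  rw [show ((i : ℕ) : ℤ) - R = -(R : ℤ) + ((i : ℕ) : ℤ) by ring]
  exact h

/-- A smooth local observable is represented on a centred box containing any prescribed site, with the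
site as an explicit box index. -/
theorem isSmoothLocal_exists_rep_site (hf : IsSmoothLocal f) (x : ℤ) :
    ∃ (R : ℕ) (g : (Fin (2 * R + 1) → ℝ × ℝ) → ℝ) (i : Fin (2 * R + 1)),
      ContDiff ℝ ∞ g ∧ f = g ∘ boxRestrict R ∧ ((i : ℤ) - R = x) := by
  obtain ⟨R₀, h⟩ := isSmoothLocal_exists_rep hf
  obtain ⟨g, hg, rfl⟩ := h (max R₀ x.natAbs) (le_max_left _ _)
  have hxR : x.natAbs ≤ max R₀ x.natAbs := le_max_right _ _
  exact ⟨max R₀ x.natAbs, g, ⟨(x + max R₀ x.natAbs).toNat, by omega⟩, hg, rfl, by simp only; omega⟩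

/-- Freezing a site at a fixed value preserves smooth locality. -/
theorem isSmoothLocal_comp_update (x : ℤ) (v : ℝ × ℝ) (hf : IsSmoothLocal f) :
    IsSmoothLocal fun σ => f (Function.update σ x v) := by
  obtain ⟨R, g, i, hg, rfl, rfl⟩ := isSmoothLocal_exists_rep_site hf x
  have hupd : ContDiff ℝ ∞ fun y : Fin (2 * R + 1) → ℝ × ℝ => Function.update y i v := by
    refine contDiff_pi.2 fun j => ?_
    by_cases hj : j = i
    · subst hj
      simpa only [Function.update_self] using contDiff_const
    · simpa only [Function.update_of_ne hj] using contDiff_apply ℝ (ℝ × ℝ) j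
  refine ⟨R, g ∘ fun y => Function.update y i v, hg.comp hupd, ?_⟩
  funext σ
  simp only [Function.comp_apply, boxRestrict_update_of_eq]

/-! ### Partial derivatives of smooth local observables -/

/-- The position partial derivative of a smooth local observable, through a profile on a box
containing the site: `∂_{q_x} (g ∘ box_R) = (Dg · e^q_i) ∘ box_R`, `x = i - R`. -/
theorem partialQZ_comp_boxRestrict {R : ℕ} {g : (Fin (2 * R + 1) → ℝ × ℝ) → ℝ} (hg : ContDiff ℝ ∞ g)
    (i : Fin (2 * R + 1)) :
    partialQZ ((i : ℤ) - R) (g ∘ boxRestrict R) =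
      (fun y => fderiv ℝ g y (Pi.single i (1, 0))) ∘ boxRestrict R := by
  funext σ
  have h := partialQZ_comp_boxRestrictAt_of_eq (-(R : ℤ)) (2 * R) (g := g) σ i
    ((hg.differentiable (by simp)) _)
  rw [show (-(R : ℤ)) + ((i : ℕ) : ℤ) = ((i : ℕ) : ℤ) - R by ring, ← boxRestrict_eq_boxRestrictAt] at h
  exact h

/-- The momentum partial derivative of a smooth local observable, through a profile on a box
containing the site. -/
theorem partialPZ_comp_boxRestrict {R : ℕ} {g : (Fin (2 * R + 1) → ℝ × ℝ) → ℝ} (hg : ContDiff ℝ ∞ g)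
    (i : Fin (2 * R + 1)) :
    partialPZ ((i : ℤ) - R) (g ∘ boxRestrict R) =
      (fun y => fderiv ℝ g y (Pi.single i (0, 1))) ∘ boxRestrict R := by
  funext σ
  have h := partialPZ_comp_boxRestrictAt_of_eq (-(R : ℤ)) (2 * R) (g := g) σ i
    ((hg.differentiable (by simp)) _)
  rw [show (-(R : ℤ)) + ((i : ℕ) : ℤ) = ((i : ℕ) : ℤ) - R by ring, ← boxRestrict_eq_boxRestrictAt] at h
  exact h

/-- `y ↦ Dg(y)·w` is smooth for a smooth profile. -/
theorem contDiff_fderiv_apply_const {R : ℕ} {g : (Fin (2 * R + 1) → ℝ × ℝ) → ℝ} (hg : ContDiff ℝ ∞ g)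
    (w : Fin (2 * R + 1) → ℝ × ℝ) : ContDiff ℝ ∞ fun y => fderiv ℝ g y w :=
  (hg.fderiv_right (m := ∞) (by simp)).clm_apply contDiff_const

/-- The position partial derivatives of a smooth local observable are smooth local. -/
theorem isSmoothLocal_partialQZ (x : ℤ) (hf : IsSmoothLocal f) : IsSmoothLocal (partialQZ x f) := by
  obtain ⟨R, g, i, hg, rfl, rfl⟩ := isSmoothLocal_exists_rep_site hf x
  rw [partialQZ_comp_boxRestrict hg i]
  exact ⟨R, _, contDiff_fderiv_apply_const hg _, rfl⟩

/-- The momentum partial derivatives of a smooth local observable are smooth local. -/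
theorem isSmoothLocal_partialPZ (x : ℤ) (hf : IsSmoothLocal f) : IsSmoothLocal (partialPZ x f) := by
  obtain ⟨R, g, i, hg, rfl, rfl⟩ := isSmoothLocal_exists_rep_site hf x
  rw [partialPZ_comp_boxRestrict hg i]
  exact ⟨R, _, contDiff_fderiv_apply_const hg _, rfl⟩

end Summit.AtomisticToContinuum.FouriersLaw.Theorems.LocalOhmBV
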